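import Summits.Ventures.PercRepro.S2DirectCell
import Summits.Ventures.PercRepro.S2FlatSharp
import Summits.Ventures.PercRepro.S2TailFlats
import Summits.Ventures.PercRepro.S2ThirteenSixSpreadNine
import Summits.Ventures.PercRepro.RankLevelSetPlaneTenPrime
import Summits.Ventures.PercRepro.S2ElevenEightK2NuSix

/-!
# PercRepro — S2: THE KEY CELLS `(13, d)`, `31 ≤ d ≤ 42` — THE ROW `p = 13` WITHOUT SUB-CELLS (p7, gen 19; sub-claim S2)

For each corank `d` here, `RLS M 13 5` on every `e`-free core of rank `13` on `13 + d` points (coloops allowed, no coloop split): the flat-sharp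
lever `topCount_le_flat_sharp` at the universal core bounds `(19, 10)` on the plain caps `cq3 d / avgChain16 d / avgChain5b d`, the tail by flats
at `(19, 10)`, and the KEY inequality `Φ(13, 5)·U + A ≤ Σ_{s=6}^{12} C(n, s)` (`c025_core_five_cell_key`, S2DirectCell) — one numeral per cell
(ratios `0.929`, `0.811`, `0.711`, `0.624`, `0.550`, `0.485`, `0.429`, `0.381`, `0.338`, `0.302`, `0.269`, `0.241`). Below `d = 31` the key cell fails (`1.07` at `d = 30`); from `d = 50` the big core S2CoreThirteen takes
over. Nothing about the window is claimed. Axioms: standard.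
-/

open scoped Matroid

namespace PercRepro

namespace ThmN

open Set

variable {α : Type}

set_option maxRecDepth 8192 in
/-- **The key cell `(13, 31)`**: `RLS M 13 5` on every `e`-free core of rank `13` on `44` points (caps `496 / 8021 / 190489`; `#U ≤ 8153876809506240270527 / 7819225514100`,
`#{r ≤ 5} ≤ 8179668200603250419137 / 7819225514100`, `Σ_{s=6}^{12} C(44, s) = 32172821278`; ratio `0.929`). -/
theorem c025_thirteen_key_31 (M : Matroid α) [M.Finite]
    (hR : M.eRank = ((13 : ℕ) : ℕ∞)) (hn : M.E.ncard = 13 + 31)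
    (hfree : ∀ e ∈ M.E, ∃ A ⊆ M.E \ {e}, e ∉ M.closure A ∧ e ∉ M.closure ((M.E \ {e}) \ A)) : RLS M 13 5 := by
  classical
  have hd : M.E.encard = M.eRank + ((31 : ℕ) : ℕ∞) := by
    rw [hR, ← M.ground_finite.cast_ncard_eq, hn]
    push_cast
    ring
  have hs3 := TriangleCap.core_ncard_triangles_le_cq3 M hfree hd
  rw [show TriangleCap.cq3 31 = 496 by decide] at hs3
  have hs4 := ncard_fourCircuits_le_avgChain16 31 M hfree hd
  rw [show avgChain16 31 = 8021 by decide] at hs4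
  have hs5 := S1.ncard_fiveCircuits_le_avgChain5b 31 M hfree hd
  rw [show S1.avgChain5b 31 = 190489 by decide] at hs5
  have hflat : ∀ X ⊆ M.E, M.eRk X ≤ 5 → X.ncard ≤ 19 := fun X hX hr => ncard_le_nineteen_of_eRk_le_five_of_free M hfree hX hr
  have hflat' : ∀ X ⊆ M.E, M.eRk X ≤ 4 → X.ncard ≤ 10 := fun X hX hr => ncard_le_ten_of_eRk_le_four_of_free M hfree hX hr
  have hU := topCount_le_flat_sharp M 13 31 (by norm_num) (by norm_num) hR hn hfree 19 10 hflat hflat' (by norm_num) (by norm_num)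
    496 8021 190489 hs3 hs4 hs5
  have hA := ncard_eRk_le_five_le_flats M 13 31 (by norm_num) hR hn hfree 19 10 hflat hflat' (by norm_num) (by norm_num)
    (by norm_num) (by norm_num) 496 8021 190489 hs3 hs4 hs5
  rw [RLS_iff]
  refine c025_core_five_cell_key M 13 31 hn _ hU _ hA (phiK 13 5) (by rw [phiK_thirteen_five]; norm_num) ?_
  rw [phiK_thirteen_five]
  norm_num [Finset.sum_range_succ, Finset.sum_Icc_succ_top, Nat.choose]

set_option maxRecDepth 8192 in
/-- **The key cell `(13, 32)`**: `RLS M 13 5` on every `e`-free core of rank `13` on `45` points (caps `528 / 8993 / 220252`; `#U ≤ 8778167279592107161928 / 7167623387925`,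
`#{r ≤ 5} ≤ 52829403756209481877453 / 43005740327550`, `Σ_{s=6}^{12} C(45, s) = 43256045951`; ratio `0.811`). -/
theorem c025_thirteen_key_32 (M : Matroid α) [M.Finite]
    (hR : M.eRank = ((13 : ℕ) : ℕ∞)) (hn : M.E.ncard = 13 + 32)
    (hfree : ∀ e ∈ M.E, ∃ A ⊆ M.E \ {e}, e ∉ M.closure A ∧ e ∉ M.closure ((M.E \ {e}) \ A)) : RLS M 13 5 := by
  classical
  have hd : M.E.encard = M.eRank + ((32 : ℕ) : ℕ∞) := by
    rw [hR, ← M.ground_finite.cast_ncard_eq, hn]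
    push_cast
    ring
  have hs3 := TriangleCap.core_ncard_triangles_le_cq3 M hfree hd
  rw [show TriangleCap.cq3 32 = 528 by decide] at hs3
  have hs4 := ncard_fourCircuits_le_avgChain16 32 M hfree hd
  rw [show avgChain16 32 = 8993 by decide] at hs4
  have hs5 := S1.ncard_fiveCircuits_le_avgChain5b 32 M hfree hd
  rw [show S1.avgChain5b 32 = 220252 by decide] at hs5
  have hflat : ∀ X ⊆ M.E, M.eRk X ≤ 5 → X.ncard ≤ 19 := fun X hX hr => ncard_le_nineteen_of_eRk_le_five_of_free M hfree hX hr
  have hflat' : ∀ X ⊆ M.E, M.eRk X ≤ 4 → X.ncard ≤ 10 := fun X hX hr => ncard_le_ten_of_eRk_le_four_of_free M hfree hX hr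
  have hU := topCount_le_flat_sharp M 13 32 (by norm_num) (by norm_num) hR hn hfree 19 10 hflat hflat' (by norm_num) (by norm_num)
    528 8993 220252 hs3 hs4 hs5
  have hA := ncard_eRk_le_five_le_flats M 13 32 (by norm_num) hR hn hfree 19 10 hflat hflat' (by norm_num) (by norm_num)
    (by norm_num) (by norm_num) 528 8993 220252 hs3 hs4 hs5
  rw [RLS_iff]
  refine c025_core_five_cell_key M 13 32 hn _ hU _ hA (phiK 13 5) (by rw [phiK_thirteen_five]; norm_num) ?_
  rw [phiK_thirteen_five]
  norm_num [Finset.sum_range_succ, Finset.sum_Icc_succ_top, Nat.choose]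

set_option maxRecDepth 8192 in
/-- **The key cell `(13, 33)`**: `RLS M 13 5` on every `e`-free core of rank `13` on `46` points (caps `561 / 10051 / 253623`; `#U ≤ 10266204279669532171072 / 7167623387925`,
`#{r ≤ 5} ≤ 10296342785971016286607 / 7167623387925`, `Σ_{s=6}^{12} C(46, s) = 57753291916`; ratio `0.711`). -/
theorem c025_thirteen_key_33 (M : Matroid α) [M.Finite]
    (hR : M.eRank = ((13 : ℕ) : ℕ∞)) (hn : M.E.ncard = 13 + 33)
    (hfree : ∀ e ∈ M.E, ∃ A ⊆ M.E \ {e}, e ∉ M.closure A ∧ e ∉ M.closure ((M.E \ {e}) \ A)) : RLS M 13 5 := by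
  classical
  have hd : M.E.encard = M.eRank + ((33 : ℕ) : ℕ∞) := by
    rw [hR, ← M.ground_finite.cast_ncard_eq, hn]
    push_cast
    ring
  have hs3 := TriangleCap.core_ncard_triangles_le_cq3 M hfree hd
  rw [show TriangleCap.cq3 33 = 561 by decide] at hs3
  have hs4 := ncard_fourCircuits_le_avgChain16 33 M hfree hd
  rw [show avgChain16 33 = 10051 by decide] at hs4
  have hs5 := S1.ncard_fiveCircuits_le_avgChain5b 33 M hfree hd
  rw [show S1.avgChain5b 33 = 253623 by decide] at hs5
  have hflat : ∀ X ⊆ M.E, M.eRk X ≤ 5 → X.ncard ≤ 19 := fun X hX hr => ncard_le_nineteen_of_eRk_le_five_of_free M hfree hX hr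
  have hflat' : ∀ X ⊆ M.E, M.eRk X ≤ 4 → X.ncard ≤ 10 := fun X hX hr => ncard_le_ten_of_eRk_le_four_of_free M hfree hX hr
  have hU := topCount_le_flat_sharp M 13 33 (by norm_num) (by norm_num) hR hn hfree 19 10 hflat hflat' (by norm_num) (by norm_num)
    561 10051 253623 hs3 hs4 hs5
  have hA := ncard_eRk_le_five_le_flats M 13 33 (by norm_num) hR hn hfree 19 10 hflat hflat' (by norm_num) (by norm_num)
    (by norm_num) (by norm_num) 561 10051 253623 hs3 hs4 hs5
  rw [RLS_iff]
  refine c025_core_five_cell_key M 13 33 hn _ hU _ hA (phiK 13 5) (by rw [phiK_thirteen_five]; norm_num) ?_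
  rw [phiK_thirteen_five]
  norm_num [Finset.sum_range_succ, Finset.sum_Icc_succ_top, Nat.choose]

set_option maxRecDepth 8192 in
/-- **The key cell `(13, 34)`**: `RLS M 13 5` on every `e`-free core of rank `13` on `47` points (caps `595 / 11199 / 290920`; `#U ≤ 1025011517545156781659 / 614367718965`,
`#{r ≤ 5} ≤ 2055831020203956234277 / 1228735437930`, `Σ_{s=6}^{12} C(47, s) = 76597336931`; ratio `0.624`). -/
theorem c025_thirteen_key_34 (M : Matroid α) [M.Finite]
    (hR : M.eRank = ((13 : ℕ) : ℕ∞)) (hn : M.E.ncard = 13 + 34)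
    (hfree : ∀ e ∈ M.E, ∃ A ⊆ M.E \ {e}, e ∉ M.closure A ∧ e ∉ M.closure ((M.E \ {e}) \ A)) : RLS M 13 5 := by
  classical
  have hd : M.E.encard = M.eRank + ((34 : ℕ) : ℕ∞) := by
    rw [hR, ← M.ground_finite.cast_ncard_eq, hn]
    push_cast
    ring
  have hs3 := TriangleCap.core_ncard_triangles_le_cq3 M hfree hd
  rw [show TriangleCap.cq3 34 = 595 by decide] at hs3
  have hs4 := ncard_fourCircuits_le_avgChain16 34 M hfree hd
  rw [show avgChain16 34 = 11199 by decide] at hs4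
  have hs5 := S1.ncard_fiveCircuits_le_avgChain5b 34 M hfree hd
  rw [show S1.avgChain5b 34 = 290920 by decide] at hs5
  have hflat : ∀ X ⊆ M.E, M.eRk X ≤ 5 → X.ncard ≤ 19 := fun X hX hr => ncard_le_nineteen_of_eRk_le_five_of_free M hfree hX hr
  have hflat' : ∀ X ⊆ M.E, M.eRk X ≤ 4 → X.ncard ≤ 10 := fun X hX hr => ncard_le_ten_of_eRk_le_four_of_free M hfree hX hr
  have hU := topCount_le_flat_sharp M 13 34 (by norm_num) (by norm_num) hR hn hfree 19 10 hflat hflat' (by norm_num) (by norm_num)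
    595 11199 290920 hs3 hs4 hs5
  have hA := ncard_eRk_le_five_le_flats M 13 34 (by norm_num) hR hn hfree 19 10 hflat hflat' (by norm_num) (by norm_num)
    (by norm_num) (by norm_num) 595 11199 290920 hs3 hs4 hs5
  rw [RLS_iff]
  refine c025_core_five_cell_key M 13 34 hn _ hU _ hA (phiK 13 5) (by rw [phiK_thirteen_five]; norm_num) ?_
  rw [phiK_thirteen_five]
  norm_num [Finset.sum_range_succ, Finset.sum_Icc_succ_top, Nat.choose]

set_option maxRecDepth 8192 in
/-- **The key cell `(13, 35)`**: `RLS M 13 5` on every `e`-free core of rank `13` on `48` points (caps `630 / 12443 / 332480`; `#U ≤ 83262847377515805839351 / 43005740327550`,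
`#{r ≤ 5} ≤ 83490743646397857949691 / 43005740327550`, `Σ_{s=6}^{12} C(48, s) = 100944806950`; ratio `0.550`). -/
theorem c025_thirteen_key_35 (M : Matroid α) [M.Finite]
    (hR : M.eRank = ((13 : ℕ) : ℕ∞)) (hn : M.E.ncard = 13 + 35)
    (hfree : ∀ e ∈ M.E, ∃ A ⊆ M.E \ {e}, e ∉ M.closure A ∧ e ∉ M.closure ((M.E \ {e}) \ A)) : RLS M 13 5 := by
  classical
  have hd : M.E.encard = M.eRank + ((35 : ℕ) : ℕ∞) := by
    rw [hR, ← M.ground_finite.cast_ncard_eq, hn]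
    push_cast
    ring
  have hs3 := TriangleCap.core_ncard_triangles_le_cq3 M hfree hd
  rw [show TriangleCap.cq3 35 = 630 by decide] at hs3
  have hs4 := ncard_fourCircuits_le_avgChain16 35 M hfree hd
  rw [show avgChain16 35 = 12443 by decide] at hs4
  have hs5 := S1.ncard_fiveCircuits_le_avgChain5b 35 M hfree hd
  rw [show S1.avgChain5b 35 = 332480 by decide] at hs5
  have hflat : ∀ X ⊆ M.E, M.eRk X ≤ 5 → X.ncard ≤ 19 := fun X hX hr => ncard_le_nineteen_of_eRk_le_five_of_free M hfree hX hr
  have hflat' : ∀ X ⊆ M.E, M.eRk X ≤ 4 → X.ncard ≤ 10 := fun X hX hr => ncard_le_ten_of_eRk_le_four_of_free M hfree hX hr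
  have hU := topCount_le_flat_sharp M 13 35 (by norm_num) (by norm_num) hR hn hfree 19 10 hflat hflat' (by norm_num) (by norm_num)
    630 12443 332480 hs3 hs4 hs5
  have hA := ncard_eRk_le_five_le_flats M 13 35 (by norm_num) hR hn hfree 19 10 hflat hflat' (by norm_num) (by norm_num)
    (by norm_num) (by norm_num) 630 12443 332480 hs3 hs4 hs5
  rw [RLS_iff]
  refine c025_core_five_cell_key M 13 35 hn _ hU _ hA (phiK 13 5) (by rw [phiK_thirteen_five]; norm_num) ?_
  rw [phiK_thirteen_five]
  norm_num [Finset.sum_range_succ, Finset.sum_Icc_succ_top, Nat.choose]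

set_option maxRecDepth 8192 in
/-- **The key cell `(13, 36)`**: `RLS M 13 5` on every `e`-free core of rank `13` on `49` points (caps `666 / 13788 / 378657`; `#U ≤ 16045752575255233840067 / 7167623387925`,
`#{r ≤ 5} ≤ 32176449385798842447439 / 14335246775850`, `Σ_{s=6}^{12} C(49, s) = 132222791736`; ratio `0.485`). -/
theorem c025_thirteen_key_36 (M : Matroid α) [M.Finite]
    (hR : M.eRank = ((13 : ℕ) : ℕ∞)) (hn : M.E.ncard = 13 + 36)
    (hfree : ∀ e ∈ M.E, ∃ A ⊆ M.E \ {e}, e ∉ M.closure A ∧ e ∉ M.closure ((M.E \ {e}) \ A)) : RLS M 13 5 := by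
  classical
  have hd : M.E.encard = M.eRank + ((36 : ℕ) : ℕ∞) := by
    rw [hR, ← M.ground_finite.cast_ncard_eq, hn]
    push_cast
    ring
  have hs3 := TriangleCap.core_ncard_triangles_le_cq3 M hfree hd
  rw [show TriangleCap.cq3 36 = 666 by decide] at hs3
  have hs4 := ncard_fourCircuits_le_avgChain16 36 M hfree hd
  rw [show avgChain16 36 = 13788 by decide] at hs4
  have hs5 := S1.ncard_fiveCircuits_le_avgChain5b 36 M hfree hd
  rw [show S1.avgChain5b 36 = 378657 by decide] at hs5
  have hflat : ∀ X ⊆ M.E, M.eRk X ≤ 5 → X.ncard ≤ 19 := fun X hX hr => ncard_le_nineteen_of_eRk_le_five_of_free M hfree hX hr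
  have hflat' : ∀ X ⊆ M.E, M.eRk X ≤ 4 → X.ncard ≤ 10 := fun X hX hr => ncard_le_ten_of_eRk_le_four_of_free M hfree hX hr
  have hU := topCount_le_flat_sharp M 13 36 (by norm_num) (by norm_num) hR hn hfree 19 10 hflat hflat' (by norm_num) (by norm_num)
    666 13788 378657 hs3 hs4 hs5
  have hA := ncard_eRk_le_five_le_flats M 13 36 (by norm_num) hR hn hfree 19 10 hflat hflat' (by norm_num) (by norm_num)
    (by norm_num) (by norm_num) 666 13788 378657 hs3 hs4 hs5
  rw [RLS_iff]
  refine c025_core_five_cell_key M 13 36 hn _ hU _ hA (phiK 13 5) (by rw [phiK_thirteen_five]; norm_num) ?_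
  rw [phiK_thirteen_five]
  norm_num [Finset.sum_range_succ, Finset.sum_Icc_succ_top, Nat.choose]

set_option maxRecDepth 8192 in
/-- **The key cell `(13, 37)`**: `RLS M 13 5` on every `e`-free core of rank `13` on `50` points (caps `703 / 15239 / 429826`; `#U ≤ 10085233902984284787397 / 3909612757050`,
`#{r ≤ 5} ≤ 5055537240623751545491 / 1954806378525`, `Σ_{s=6}^{12} C(50, s) = 172183755520`; ratio `0.429`). -/
theorem c025_thirteen_key_37 (M : Matroid α) [M.Finite]
    (hR : M.eRank = ((13 : ℕ) : ℕ∞)) (hn : M.E.ncard = 13 + 37)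
    (hfree : ∀ e ∈ M.E, ∃ A ⊆ M.E \ {e}, e ∉ M.closure A ∧ e ∉ M.closure ((M.E \ {e}) \ A)) : RLS M 13 5 := by
  classical
  have hd : M.E.encard = M.eRank + ((37 : ℕ) : ℕ∞) := by
    rw [hR, ← M.ground_finite.cast_ncard_eq, hn]
    push_cast
    ring
  have hs3 := TriangleCap.core_ncard_triangles_le_cq3 M hfree hd
  rw [show TriangleCap.cq3 37 = 703 by decide] at hs3
  have hs4 := ncard_fourCircuits_le_avgChain16 37 M hfree hd
  rw [show avgChain16 37 = 15239 by decide] at hs4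
  have hs5 := S1.ncard_fiveCircuits_le_avgChain5b 37 M hfree hd
  rw [show S1.avgChain5b 37 = 429826 by decide] at hs5
  have hflat : ∀ X ⊆ M.E, M.eRk X ≤ 5 → X.ncard ≤ 19 := fun X hX hr => ncard_le_nineteen_of_eRk_le_five_of_free M hfree hX hr
  have hflat' : ∀ X ⊆ M.E, M.eRk X ≤ 4 → X.ncard ≤ 10 := fun X hX hr => ncard_le_ten_of_eRk_le_four_of_free M hfree hX hr
  have hU := topCount_le_flat_sharp M 13 37 (by norm_num) (by norm_num) hR hn hfree 19 10 hflat hflat' (by norm_num) (by norm_num)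
    703 15239 429826 hs3 hs4 hs5
  have hA := ncard_eRk_le_five_le_flats M 13 37 (by norm_num) hR hn hfree 19 10 hflat hflat' (by norm_num) (by norm_num)
    (by norm_num) (by norm_num) 703 15239 429826 hs3 hs4 hs5
  rw [RLS_iff]
  refine c025_core_five_cell_key M 13 37 hn _ hU _ hA (phiK 13 5) (by rw [phiK_thirteen_five]; norm_num) ?_
  rw [phiK_thirteen_five]
  norm_num [Finset.sum_range_succ, Finset.sum_Icc_succ_top, Nat.choose]

set_option maxRecDepth 8192 in
/-- **The key cell `(13, 38)`**: `RLS M 13 5` on every `e`-free core of rank `13` on `51` points (caps `741 / 16801 / 486382`; `#U ≤ 84943143198288982186519 / 28670493551700`,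
`#{r ≤ 5} ≤ 85154010496800751696129 / 28670493551700`, `Σ_{s=6}^{12} C(51, s) = 222969978700`; ratio `0.381`). -/
theorem c025_thirteen_key_38 (M : Matroid α) [M.Finite]
    (hR : M.eRank = ((13 : ℕ) : ℕ∞)) (hn : M.E.ncard = 13 + 38)
    (hfree : ∀ e ∈ M.E, ∃ A ⊆ M.E \ {e}, e ∉ M.closure A ∧ e ∉ M.closure ((M.E \ {e}) \ A)) : RLS M 13 5 := by
  classical
  have hd : M.E.encard = M.eRank + ((38 : ℕ) : ℕ∞) := by
    rw [hR, ← M.ground_finite.cast_ncard_eq, hn]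
    push_cast
    ring
  have hs3 := TriangleCap.core_ncard_triangles_le_cq3 M hfree hd
  rw [show TriangleCap.cq3 38 = 741 by decide] at hs3
  have hs4 := ncard_fourCircuits_le_avgChain16 38 M hfree hd
  rw [show avgChain16 38 = 16801 by decide] at hs4
  have hs5 := S1.ncard_fiveCircuits_le_avgChain5b 38 M hfree hd
  rw [show S1.avgChain5b 38 = 486382 by decide] at hs5
  have hflat : ∀ X ⊆ M.E, M.eRk X ≤ 5 → X.ncard ≤ 19 := fun X hX hr => ncard_le_nineteen_of_eRk_le_five_of_free M hfree hX hr
  have hflat' : ∀ X ⊆ M.E, M.eRk X ≤ 4 → X.ncard ≤ 10 := fun X hX hr => ncard_le_ten_of_eRk_le_four_of_free M hfree hX hr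
  have hU := topCount_le_flat_sharp M 13 38 (by norm_num) (by norm_num) hR hn hfree 19 10 hflat hflat' (by norm_num) (by norm_num)
    741 16801 486382 hs3 hs4 hs5
  have hA := ncard_eRk_le_five_le_flats M 13 38 (by norm_num) hR hn hfree 19 10 hflat hflat' (by norm_num) (by norm_num)
    (by norm_num) (by norm_num) 741 16801 486382 hs3 hs4 hs5
  rw [RLS_iff]
  refine c025_core_five_cell_key M 13 38 hn _ hU _ hA (phiK 13 5) (by rw [phiK_thirteen_five]; norm_num) ?_
  rw [phiK_thirteen_five]
  norm_num [Finset.sum_range_succ, Finset.sum_Icc_succ_top, Nat.choose]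

set_option maxRecDepth 8192 in
/-- **The key cell `(13, 39)`**: `RLS M 13 5` on every `e`-free core of rank `13` on `52` points (caps `780 / 18481 / 548738`; `#U ≤ 145884625808304381119587 / 43005740327550`,
`#{r ≤ 5} ≤ 146235804332613487483457 / 43005740327550`, `Σ_{s=6}^{12} C(52, s) = 287188916560`; ratio `0.338`). -/
theorem c025_thirteen_key_39 (M : Matroid α) [M.Finite]
    (hR : M.eRank = ((13 : ℕ) : ℕ∞)) (hn : M.E.ncard = 13 + 39)
    (hfree : ∀ e ∈ M.E, ∃ A ⊆ M.E \ {e}, e ∉ M.closure A ∧ e ∉ M.closure ((M.E \ {e}) \ A)) : RLS M 13 5 := by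
  classical
  have hd : M.E.encard = M.eRank + ((39 : ℕ) : ℕ∞) := by
    rw [hR, ← M.ground_finite.cast_ncard_eq, hn]
    push_cast
    ring
  have hs3 := TriangleCap.core_ncard_triangles_le_cq3 M hfree hd
  rw [show TriangleCap.cq3 39 = 780 by decide] at hs3
  have hs4 := ncard_fourCircuits_le_avgChain16 39 M hfree hd
  rw [show avgChain16 39 = 18481 by decide] at hs4
  have hs5 := S1.ncard_fiveCircuits_le_avgChain5b 39 M hfree hd
  rw [show S1.avgChain5b 39 = 548738 by decide] at hs5
  have hflat : ∀ X ⊆ M.E, M.eRk X ≤ 5 → X.ncard ≤ 19 := fun X hX hr => ncard_le_nineteen_of_eRk_le_five_of_free M hfree hX hr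
  have hflat' : ∀ X ⊆ M.E, M.eRk X ≤ 4 → X.ncard ≤ 10 := fun X hX hr => ncard_le_ten_of_eRk_le_four_of_free M hfree hX hr
  have hU := topCount_le_flat_sharp M 13 39 (by norm_num) (by norm_num) hR hn hfree 19 10 hflat hflat' (by norm_num) (by norm_num)
    780 18481 548738 hs3 hs4 hs5
  have hA := ncard_eRk_le_five_le_flats M 13 39 (by norm_num) hR hn hfree 19 10 hflat hflat' (by norm_num) (by norm_num)
    (by norm_num) (by norm_num) 780 18481 548738 hs3 hs4 hs5
  rw [RLS_iff]
  refine c025_core_five_cell_key M 13 39 hn _ hU _ hA (phiK 13 5) (by rw [phiK_thirteen_five]; norm_num) ?_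
  rw [phiK_thirteen_five]
  norm_num [Finset.sum_range_succ, Finset.sum_Icc_succ_top, Nat.choose]

set_option maxRecDepth 8192 in
/-- **The key cell `(13, 40)`**: `RLS M 13 5` on every `e`-free core of rank `13` on `53` points (caps `820 / 20284 / 617330`; `#U ≤ 11895275273485161830872 / 3071838594825`,
`#{r ≤ 5} ≤ 11923064987668530598502 / 3071838594825`, `Σ_{s=6}^{12} C(53, s) = 368001025210`; ratio `0.302`). -/
theorem c025_thirteen_key_40 (M : Matroid α) [M.Finite]
    (hR : M.eRank = ((13 : ℕ) : ℕ∞)) (hn : M.E.ncard = 13 + 40)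
    (hfree : ∀ e ∈ M.E, ∃ A ⊆ M.E \ {e}, e ∉ M.closure A ∧ e ∉ M.closure ((M.E \ {e}) \ A)) : RLS M 13 5 := by
  classical
  have hd : M.E.encard = M.eRank + ((40 : ℕ) : ℕ∞) := by
    rw [hR, ← M.ground_finite.cast_ncard_eq, hn]
    push_cast
    ring
  have hs3 := TriangleCap.core_ncard_triangles_le_cq3 M hfree hd
  rw [show TriangleCap.cq3 40 = 820 by decide] at hs3
  have hs4 := ncard_fourCircuits_le_avgChain16 40 M hfree hd
  rw [show avgChain16 40 = 20284 by decide] at hs4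
  have hs5 := S1.ncard_fiveCircuits_le_avgChain5b 40 M hfree hd
  rw [show S1.avgChain5b 40 = 617330 by decide] at hs5
  have hflat : ∀ X ⊆ M.E, M.eRk X ≤ 5 → X.ncard ≤ 19 := fun X hX hr => ncard_le_nineteen_of_eRk_le_five_of_free M hfree hX hr
  have hflat' : ∀ X ⊆ M.E, M.eRk X ≤ 4 → X.ncard ≤ 10 := fun X hX hr => ncard_le_ten_of_eRk_le_four_of_free M hfree hX hr
  have hU := topCount_le_flat_sharp M 13 40 (by norm_num) (by norm_num) hR hn hfree 19 10 hflat hflat' (by norm_num) (by norm_num)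
    820 20284 617330 hs3 hs4 hs5
  have hA := ncard_eRk_le_five_le_flats M 13 40 (by norm_num) hR hn hfree 19 10 hflat hflat' (by norm_num) (by norm_num)
    (by norm_num) (by norm_num) 820 20284 617330 hs3 hs4 hs5
  rw [RLS_iff]
  refine c025_core_five_cell_key M 13 40 hn _ hU _ hA (phiK 13 5) (by rw [phiK_thirteen_five]; norm_num) ?_
  rw [phiK_thirteen_five]
  norm_num [Finset.sum_range_succ, Finset.sum_Icc_succ_top, Nat.choose]

set_option maxRecDepth 8192 in
/-- **The key cell `(13, 41)`**: `RLS M 13 5` on every `e`-free core of rank `13` on `54` points (caps `861 / 22215 / 692614`; `#U ≤ 10832068503638809969397 / 2457470875860`,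
`#{r ≤ 5} ≤ 10856646584862541871263 / 2457470875860`, `Σ_{s=6}^{12} C(54, s) = 469221784395`; ratio `0.269`). -/
theorem c025_thirteen_key_41 (M : Matroid α) [M.Finite]
    (hR : M.eRank = ((13 : ℕ) : ℕ∞)) (hn : M.E.ncard = 13 + 41)
    (hfree : ∀ e ∈ M.E, ∃ A ⊆ M.E \ {e}, e ∉ M.closure A ∧ e ∉ M.closure ((M.E \ {e}) \ A)) : RLS M 13 5 := by
  classical
  have hd : M.E.encard = M.eRank + ((41 : ℕ) : ℕ∞) := by
    rw [hR, ← M.ground_finite.cast_ncard_eq, hn]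
    push_cast
    ring
  have hs3 := TriangleCap.core_ncard_triangles_le_cq3 M hfree hd
  rw [show TriangleCap.cq3 41 = 861 by decide] at hs3
  have hs4 := ncard_fourCircuits_le_avgChain16 41 M hfree hd
  rw [show avgChain16 41 = 22215 by decide] at hs4
  have hs5 := S1.ncard_fiveCircuits_le_avgChain5b 41 M hfree hd
  rw [show S1.avgChain5b 41 = 692614 by decide] at hs5
  have hflat : ∀ X ⊆ M.E, M.eRk X ≤ 5 → X.ncard ≤ 19 := fun X hX hr => ncard_le_nineteen_of_eRk_le_five_of_free M hfree hX hr
  have hflat' : ∀ X ⊆ M.E, M.eRk X ≤ 4 → X.ncard ≤ 10 := fun X hX hr => ncard_le_ten_of_eRk_le_four_of_free M hfree hX hr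
  have hU := topCount_le_flat_sharp M 13 41 (by norm_num) (by norm_num) hR hn hfree 19 10 hflat hflat' (by norm_num) (by norm_num)
    861 22215 692614 hs3 hs4 hs5
  have hA := ncard_eRk_le_five_le_flats M 13 41 (by norm_num) hR hn hfree 19 10 hflat hflat' (by norm_num) (by norm_num)
    (by norm_num) (by norm_num) 861 22215 692614 hs3 hs4 hs5
  rw [RLS_iff]
  refine c025_core_five_cell_key M 13 41 hn _ hU _ hA (phiK 13 5) (by rw [phiK_thirteen_five]; norm_num) ?_
  rw [phiK_thirteen_five]
  norm_num [Finset.sum_range_succ, Finset.sum_Icc_succ_top, Nat.choose]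

set_option maxRecDepth 8192 in
/-- **The key cell `(13, 42)`**: `RLS M 13 5` on every `e`-free core of rank `13` on `55` points (caps `903 / 24281 / 775068`; `#U ≤ 11954656767905498070657 / 2389207795975`,
`#{r ≤ 5} ≤ 509830695763733151967 / 101668416850`, `Σ_{s=6}^{12} C(55, s) = 595439842530`; ratio `0.241`). -/
theorem c025_thirteen_key_42 (M : Matroid α) [M.Finite]
    (hR : M.eRank = ((13 : ℕ) : ℕ∞)) (hn : M.E.ncard = 13 + 42)
    (hfree : ∀ e ∈ M.E, ∃ A ⊆ M.E \ {e}, e ∉ M.closure A ∧ e ∉ M.closure ((M.E \ {e}) \ A)) : RLS M 13 5 := by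
  classical
  have hd : M.E.encard = M.eRank + ((42 : ℕ) : ℕ∞) := by
    rw [hR, ← M.ground_finite.cast_ncard_eq, hn]
    push_cast
    ring
  have hs3 := TriangleCap.core_ncard_triangles_le_cq3 M hfree hd
  rw [show TriangleCap.cq3 42 = 903 by decide] at hs3
  have hs4 := ncard_fourCircuits_le_avgChain16 42 M hfree hd
  rw [show avgChain16 42 = 24281 by decide] at hs4
  have hs5 := S1.ncard_fiveCircuits_le_avgChain5b 42 M hfree hd
  rw [show S1.avgChain5b 42 = 775068 by decide] at hs5
  have hflat : ∀ X ⊆ M.E, M.eRk X ≤ 5 → X.ncard ≤ 19 := fun X hX hr => ncard_le_nineteen_of_eRk_le_five_of_free M hfree hX hr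
  have hflat' : ∀ X ⊆ M.E, M.eRk X ≤ 4 → X.ncard ≤ 10 := fun X hX hr => ncard_le_ten_of_eRk_le_four_of_free M hfree hX hr
  have hU := topCount_le_flat_sharp M 13 42 (by norm_num) (by norm_num) hR hn hfree 19 10 hflat hflat' (by norm_num) (by norm_num)
    903 24281 775068 hs3 hs4 hs5
  have hA := ncard_eRk_le_five_le_flats M 13 42 (by norm_num) hR hn hfree 19 10 hflat hflat' (by norm_num) (by norm_num)
    (by norm_num) (by norm_num) 903 24281 775068 hs3 hs4 hs5
  rw [RLS_iff]
  refine c025_core_five_cell_key M 13 42 hn _ hU _ hA (phiK 13 5) (by rw [phiK_thirteen_five]; norm_num) ?_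
  rw [phiK_thirteen_five]
  norm_num [Finset.sum_range_succ, Finset.sum_Icc_succ_top, Nat.choose]


end ThmN

end PercRepro
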